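import Summits.BirchSwinnertonDyer.BirchSwinnertonDyer.Theorems.ByReductionTypeAtTwoTowerLambdaRankAdditive
import Literature.NumberTheory.EllipticCurves.ArchimedeanKummerImageMaximal
import Literature.NumberTheory.EllipticCurves.TwoTorsionCardProofs
import HarnessLib

/-!
# A TORSION CERTIFICATE AT EVERY LAYER for a curve with ONE rational `2`-torsion point: one Galois
# element moving `√r` and `√s` (`r = ψ₂′(e₁)/4 = (e₁−e₂)(e₁−e₃)`, `s` = the resolvent discriminant of the
# other two `2`-torsion abscissae) fixes at most `{O, T}` in `E[2^∞]`; hence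
# `#E[2^∞]^{Gal(ℚ̄/ℚ_j)} ≤ 2` as soon as such an element lies in `Gal(ℚ̄/ℚ_j)` — the `t = 1` input of the
# torsion-tolerant RANK certificate `towerRank_of_layerClasses_of_torsion` at layers `j ≥ 1`
# (route ByReductionTypeAtTwo, items 19577 / 19573; seat bsd-2adic-ord-3 GEN 6)

HONEST FRAMING (cell `bsd-2adic`, run/shared/lean/pub/bsd-2adic/, HUMAN RULINGS D-0036 / D-0054 / D-0074): THEOREMS
ONLY (elementary algebra of the group law + Galois action on coordinates); nothing asserted; no definition; no named
fact; closes nothing by itself. The Galois element is a HYPOTHESIS here (`hσr`, `hσs`, `hσ`): supplying it — a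
Frobenius at a prime `ℓ ≡ ±1 (mod 2^{j+2})` with `(r/ℓ) = (s/ℓ) = −1`, which lies in `κ.layerSubgroup j`
by tower-1's `‖κ(res Frob_ℓ)‖ = 2^{−(v₂(ℓ²−1)−3)}` and acts on `√r`, `√s` by Euler's criterion — is the
Galois-bookkeeping lane's (WANTED, STATUS 2026-08-26T21:1xZ). First consumer: 469737k1 (`#Ш_an = 64`,
`E(ℚ)_tors ≅ ℤ/2`, additive at `3`; `r ∼ 123·□`, `s ∼ 1273·□`, `ℓ = 127`).

THE ARGUMENT (Silverman AEC III.2.3 (d), VIII.§1). Let `E/ℚ` have a rational point `T = (e₁, ·)` of order `2`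
(`ψ₂`-cubic `g(e₁) = 0`, `g(X) = 4X³ + b₂X² + 2b₄X + b₆`), and let `σ ∈ Γ_ℚ` fix NO square root of
`r := g′(e₁)/4` and NO square root of `s := B² − 16C`, where `g(X) = (X − e₁)(4X² + BX + C)`
(`B = b₂ + 4e₁`, `C = 2b₄ + b₂e₁ + 4e₁²`). Then every `σ`-fixed `m ∈ E(ℚ̄)[2^∞]` is `O` or `T`:
(i) a `σ`-fixed point `U` of order `2` has `g(x(U)) = 0` (tree `isRoot_twoTorsionPolynomial_of_add_self_eq_zero`);
if `x(U) ≠ e₁` then `(8x(U) + B)² = s` with `8x(U) + B` fixed by `σ` — excluded; so `x(U) = e₁`;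
(ii) if `2P = U` with `P = (x, y)` fixed by `σ`, the duplication formula measured from `e₁` (tree
`four_mul_addX_self_sub_mul_sq`: `4(x(2P) − e₁)ψ₂(P)² = (2(x − e₁)² − g′(e₁)/2)²`) gives `(x − e₁)² = r` with
`x − e₁` fixed by `σ` — excluded; (iii) so a nonzero fixed `m` of order `2^k` has `k = 1` (else apply (ii) to
`P = 2^{k−2}m`, `U = 2^{k−1}m`) and `x(m) = e₁`, `y(m) = −(a₁e₁ + a₃)/2`: at most ONE nonzero fixed point.
§2 turns this into the layer-`j` torsion count `Nat.card {m : E[2^∞] | ∀ τ ∈ κ.layerSubgroup j, τ • m = m} ≤ 2^1`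
(given `σ ∈ κ.layerSubgroup j`), the `htor` input (with `t = 1`) of
`TowerLambdaTorsion.towerRank_of_layerSelmer_of_torsion` / `towerRank_of_layerClasses_of_torsion` and of
ord-2's torsion-tolerant gap doors at ANY layer pair `(j, j')`.
References: [SilvermanAEC2009] III.2.3 (d), III Ex. 3.7, VIII.§1; [GreenbergLNM1716] §3 pp. 85–86, §4 Lemma 4.3.
-/

set_option autoImplicit false
-- the sub-problem namespace repeats the summit name by design (D-0017 nested layout)
set_option linter.dupNamespace false

noncomputable section

open scoped Classical

open Polynomial WeierstrassCurve Literature.NumberTheory.EllipticCurves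

namespace Summit.BirchSwinnertonDyer.BirchSwinnertonDyer.Theorems.TowerLambdaTorsion

section Coordinates

variable {F : Type*} [Field F] {K : Type*} [Field K] [Algebra F K] (V : WeierstrassCurve F)

/-- A point fixed by a Galois automorphism has a fixed `x`-coordinate. [folklore] -/
theorem algEquiv_x_eq_of_map_eq (σ : K ≃ₐ[F] K) {x y : K} {h : (V.baseChange K).toAffine.Nonsingular x y}
    (hfix : Affine.Point.map (σ : K →ₐ[F] K) (Affine.Point.some x y h) = Affine.Point.some x y h) : σ x = x := by
  simp only [Affine.Point.map_some, Affine.Point.some.injEq] at hfix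
  simpa using hfix.1

/-- A nonzero affine point has coordinates. [folklore] -/
theorem exists_eq_some_of_ne_zero {P : (V.baseChange K).toAffine.Point} (hP : P ≠ 0) :
    ∃ (x y : K) (h : (V.baseChange K).toAffine.Nonsingular x y), P = Affine.Point.some x y h := by
  rcases P with _ | ⟨x, y, h⟩
  · exact absurd rfl hP
  · exact ⟨x, y, h, rfl⟩

end Coordinates

section Algebra

variable {K : Type*} [Field K]

/-- The `2`-division cubic splits off its root `e₁`: `g(X) − g(e₁) = (X − e₁)(4X² + BX + C)` with
`B = b₂ + 4e₁`, `C = 2b₄ + b₂e₁ + 4e₁²`. [folklore] -/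
theorem twoTorsionCubic_sub_eq_mul (b₂ b₄ b₆ e X : K) :
    (4 * X ^ 3 + b₂ * X ^ 2 + 2 * b₄ * X + b₆) - (4 * e ^ 3 + b₂ * e ^ 2 + 2 * b₄ * e + b₆) =
      (X - e) * (4 * X ^ 2 + (b₂ + 4 * e) * X + (2 * b₄ + b₂ * e + 4 * e ^ 2)) := by
  ring

/-- A root of `4X² + BX + C` makes `8X + B` a square root of the resolvent discriminant `B² − 16C`. [folklore] -/
theorem sq_eq_disc_of_quadratic_eq_zero {B C X : K} (h : 4 * X ^ 2 + B * X + C = 0) :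
    (8 * X + B) ^ 2 = B ^ 2 - 16 * C := by
  linear_combination (16 : K) * h

/-- `2^{n+1} • a = 2^n • a + 2^n • a`. [folklore] -/
theorem two_pow_succ_nsmul {A : Type*} [AddCommMonoid A] (a : A) (n : ℕ) :
    2 ^ (n + 1) • a = 2 ^ n • a + 2 ^ n • a := by
  rw [pow_succ, mul_nsmul, two_nsmul]

end Algebra

section Galois

variable (W : WeierstrassCurve ℚ)

/-- **One Galois element moving `√r` and `√s` fixes at most `{O, T}` in `E(ℚ̄)[2^∞]`** (module docstring
(i)–(iii)). Data: a rational `2`-torsion abscissa `e₁` (`g(e₁) = 0`), `2r = g′(e₁)/2`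
(`= a₁²e₁ + a₁a₃ + 4a₂e₁ + 2a₄ + 6e₁²`), `s = B² − 16C`; hypotheses: `σ` fixes no `α` with `α² = r` and no
`β` with `β² = s`. Conclusion: any two nonzero `σ`-fixed points of `E(ℚ̄)[2^∞]` are equal.
[cite: SilvermanAEC2009, III.2.3 (d), III Ex. 3.7 and VIII.§1] -/
theorem eq_of_smul_eq_of_smul_eq (σ : Field.absoluteGaloisGroup ℚ) (e₁ r s : ℚ)
    (he₁ : 4 * e₁ ^ 3 + W.b₂ * e₁ ^ 2 + 2 * W.b₄ * e₁ + W.b₆ = 0)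
    (hr : 2 * r = W.a₁ ^ 2 * e₁ + W.a₁ * W.a₃ + 4 * W.a₂ * e₁ + 2 * W.a₄ + 6 * e₁ ^ 2)
    (hs : s = (W.b₂ + 4 * e₁) ^ 2 - 16 * (2 * W.b₄ + W.b₂ * e₁ + 4 * e₁ ^ 2))
    (hσr : ∀ α : AlgebraicClosure ℚ, α ^ 2 = algebraMap ℚ (AlgebraicClosure ℚ) r →
      (show AlgebraicClosure ℚ ≃ₐ[ℚ] AlgebraicClosure ℚ from σ) α ≠ α)
    (hσs : ∀ β : AlgebraicClosure ℚ, β ^ 2 = algebraMap ℚ (AlgebraicClosure ℚ) s →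
      (show AlgebraicClosure ℚ ≃ₐ[ℚ] AlgebraicClosure ℚ from σ) β ≠ β)
    {m m' : geomPrimaryTorsion W 2} (hm : σ • m = m) (hm0 : m ≠ 0) (hm' : σ • m' = m') (hm0' : m' ≠ 0) :
    m = m' := by
  -- notation: the algebraic closure, `σ` as a field automorphism, the base-changed curve
  set Kb := AlgebraicClosure ℚ
  set σ' : Kb ≃ₐ[ℚ] Kb := σ with hσ'
  set V : WeierstrassCurve Kb := W.baseChange Kb with hVdef
  have hV2 : (2 : Kb) ≠ 0 := two_ne_zero
  -- the rational data pushed to `Kb`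
  set E₁ : Kb := algebraMap ℚ Kb e₁ with hE₁
  have hVa₁ : V.a₁ = algebraMap ℚ Kb W.a₁ := rfl
  have hVa₂ : V.a₂ = algebraMap ℚ Kb W.a₂ := rfl
  have hVa₃ : V.a₃ = algebraMap ℚ Kb W.a₃ := rfl
  have hVa₄ : V.a₄ = algebraMap ℚ Kb W.a₄ := rfl
  have hVb₂ : V.b₂ = algebraMap ℚ Kb W.b₂ := by rw [hVdef, WeierstrassCurve.baseChange, map_b₂]
  have hVb₄ : V.b₄ = algebraMap ℚ Kb W.b₄ := by rw [hVdef, WeierstrassCurve.baseChange, map_b₄]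
  have hVb₆ : V.b₆ = algebraMap ℚ Kb W.b₆ := by rw [hVdef, WeierstrassCurve.baseChange, map_b₆]
  have he₁K : 4 * E₁ ^ 3 + V.b₂ * E₁ ^ 2 + 2 * V.b₄ * E₁ + V.b₆ = 0 := by
    have h := congrArg (algebraMap ℚ Kb) he₁
    rw [map_zero] at h
    rw [← h, hVb₂, hVb₄, hVb₆, hE₁]
    simp only [map_add, map_mul, map_pow, map_ofNat]
  have hrK : 2 * algebraMap ℚ Kb r = V.a₁ ^ 2 * E₁ + V.a₁ * V.a₃ + 4 * V.a₂ * E₁ + 2 * V.a₄ + 6 * E₁ ^ 2 := by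
    have h := congrArg (algebraMap ℚ Kb) hr
    rw [hVa₁, hVa₂, hVa₃, hVa₄, hE₁]
    simpa only [map_add, map_mul, map_pow, map_ofNat] using h
  have hsK : algebraMap ℚ Kb s = (V.b₂ + 4 * E₁) ^ 2 - 16 * (2 * V.b₄ + V.b₂ * E₁ + 4 * E₁ ^ 2) := by
    rw [hs, hVb₂, hVb₄, hE₁]
    simp only [map_add, map_sub, map_mul, map_pow, map_ofNat]
  -- the action on the ambient points is `Point.map σ'`, and it commutes with `n • ·`
  have hact : ∀ P : geomPoints W, σ • P = Affine.Point.map (σ' : Kb →ₐ[ℚ] Kb) P := fun P ↦ rfl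
  have hact' : ∀ n : ℕ, ∀ P : geomPoints W, σ • (n • P) = n • (σ • P) := fun n P ↦
    map_nsmul (DistribSMul.toAddMonoidHom (geomPoints W) σ) n P
  -- STEP (i): a nonzero `σ`-fixed `2`-torsion point has `x = e₁`
  have step_i : ∀ {x y : Kb} {h : V.toAffine.Nonsingular x y},
      Affine.Point.map (σ' : Kb →ₐ[ℚ] Kb) (Affine.Point.some x y h) = Affine.Point.some x y h →
      Affine.Point.some x y h + Affine.Point.some x y h = 0 →
      x = E₁ ∧ y = V.toAffine.negY x y := by
    intro x y h hfix h2
    obtain ⟨hy, hroot⟩ := V.isRoot_twoTorsionPolynomial_of_add_self_eq_zero h2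
    have hg : 4 * x ^ 3 + V.b₂ * x ^ 2 + 2 * V.b₄ * x + V.b₆ = 0 := by
      simpa only [twoTorsionPolynomial, Cubic.toPoly, IsRoot.def, eval_add, eval_mul, eval_C, eval_pow,
        eval_X] using hroot
    have hσx : σ' x = x := algEquiv_x_eq_of_map_eq W σ' hfix
    refine ⟨?_, hy⟩
    by_contra hne
    -- `x` is a root of the quadratic cofactor
    have hfac := twoTorsionCubic_sub_eq_mul V.b₂ V.b₄ V.b₆ E₁ x
    rw [hg, he₁K, sub_zero] at hfac
    have hquad : 4 * x ^ 2 + (V.b₂ + 4 * E₁) * x + (2 * V.b₄ + V.b₂ * E₁ + 4 * E₁ ^ 2) = 0 := by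
      rcases mul_eq_zero.mp hfac.symm with h0 | h0
      · exact absurd (sub_eq_zero.mp h0) hne
      · exact h0
    have hβ := sq_eq_disc_of_quadratic_eq_zero hquad
    -- `β = 8x + B` is fixed by `σ` and squares to `s`
    refine hσs (8 * x + (V.b₂ + 4 * E₁)) (by rw [hβ, hsK]) ?_
    change σ' (8 * x + (V.b₂ + 4 * E₁)) = 8 * x + (V.b₂ + 4 * E₁)
    rw [hVb₂, hE₁]
    simp only [map_add, map_mul, map_ofNat, hσx, AlgEquiv.commutes]
  -- STEP (ii): no `σ`-fixed `P` doubles onto a point of order `2` with abscissa `e₁`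
  have step_ii : ∀ {x y : Kb} {h : V.toAffine.Nonsingular x y} {y' : Kb} {h' : V.toAffine.Nonsingular E₁ y'},
      Affine.Point.map (σ' : Kb →ₐ[ℚ] Kb) (Affine.Point.some x y h) = Affine.Point.some x y h →
      y' = V.toAffine.negY E₁ y' →
      Affine.Point.some x y h + Affine.Point.some x y h = Affine.Point.some E₁ y' h' → False := by
    intro x y h y' h' hfix hy' h2
    have hσx : σ' x = x := algEquiv_x_eq_of_map_eq W σ' hfix
    -- `P` is not of order `2`
    have hy : y ≠ V.toAffine.negY x y := by
      intro hy
      rw [Affine.Point.add_self_of_Y_eq (h₁ := h) hy] at h2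
      exact Affine.Point.some_ne_zero _ h2.symm
    rw [Affine.Point.add_self_of_Y_ne hy] at h2
    injection h2 with hX _
    -- the duplication identity measured from `e₁`
    have heq : y ^ 2 + V.a₁ * x * y + V.a₃ * y = x ^ 3 + V.a₂ * x ^ 2 + V.a₄ * x + V.a₆ :=
      (Affine.equation_iff _ _).mp h.left
    have heq' : y' ^ 2 + V.a₁ * E₁ * y' + V.a₃ * y' = E₁ ^ 3 + V.a₂ * E₁ ^ 2 + V.a₄ * E₁ + V.a₆ :=
      (Affine.equation_iff _ _).mp h'.left
    have hT' : y' = -y' - V.a₁ * E₁ - V.a₃ := hy'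
    have hD : y - (-y - V.a₁ * x - V.a₃) ≠ 0 := sub_ne_zero.mpr hy
    have hℓ : V.toAffine.slope x x y y * (y - (-y - V.a₁ * x - V.a₃)) =
        3 * x ^ 2 + 2 * V.a₂ * x + V.a₄ - V.a₁ * y := by
      rw [Affine.slope_of_Y_ne rfl hy]
      exact div_mul_cancel₀ _ hD
    have key := V.toAffine.four_mul_addX_self_sub_mul_sq heq heq' hT' hℓ
    rw [hX, sub_self, mul_zero, zero_mul] at key
    have hsq : 2 * (x - E₁) ^ 2 = V.a₁ ^ 2 * E₁ + V.a₁ * V.a₃ + 4 * V.a₂ * E₁ + 2 * V.a₄ + 6 * E₁ ^ 2 :=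
      sub_eq_zero.mp (pow_eq_zero_iff two_ne_zero |>.mp key.symm)
    have hα : (x - E₁) ^ 2 = algebraMap ℚ Kb r := mul_left_cancel₀ hV2 (hsq.trans hrK.symm)
    refine hσr (x - E₁) hα ?_
    change σ' (x - E₁) = x - E₁
    rw [map_sub, hσx, hE₁, AlgEquiv.commutes]
  -- STEP (iii): every nonzero `σ`-fixed `m ∈ E[2^∞]` is the point `(e₁, −(a₁e₁+a₃)/2)`
  have step_iii : ∀ {m : geomPrimaryTorsion W 2}, σ • m = m → m ≠ 0 →
      ∃ (y : Kb) (h : V.toAffine.Nonsingular E₁ y), y = V.toAffine.negY E₁ y ∧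
        (m : geomPoints W) = Affine.Point.some E₁ y h := by
    intro m hm hm0
    have hfixm : σ • (m : geomPoints W) = m := by rw [← primaryComponent.coe_smul, hm]
    have hex : ∃ k : ℕ, 2 ^ k • (m : geomPoints W) = 0 := m.2
    have hk : 2 ^ Nat.find hex • (m : geomPoints W) = 0 := Nat.find_spec hex
    have hk0 : Nat.find hex ≠ 0 := by
      intro h0
      rw [h0, pow_zero, one_nsmul] at hk
      exact hm0 (Subtype.ext hk)
    have hk1le : 1 ≤ Nat.find hex := Nat.one_le_iff_ne_zero.mpr hk0
    -- `U = 2^(k-1) m` has exact order `2` and is fixed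
    set U : geomPoints W := 2 ^ (Nat.find hex - 1) • (m : geomPoints W) with hU
    have hU0 : U ≠ 0 := fun h0 ↦ Nat.find_min hex (m := Nat.find hex - 1) (by omega) h0
    have hU2 : U + U = 0 := by
      have h1 : 2 ^ (Nat.find hex - 1 + 1) • (m : geomPoints W) = 0 := by rwa [Nat.sub_add_cancel hk1le]
      rwa [two_pow_succ_nsmul] at h1
    have hUfix : σ • U = U := by rw [hU, hact', hfixm]
    obtain ⟨xU, yU, hUns, hUeq⟩ := exists_eq_some_of_ne_zero W (K := Kb) hU0
    rw [hUeq, hact] at hUfix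
    rw [hUeq] at hU2
    obtain ⟨hxU, hyU⟩ := step_i hUfix hU2
    subst hxU
    -- `k = 1`: otherwise `P = 2^(k-2) m` halves `U` and is fixed
    have hk1 : Nat.find hex = 1 := by
      by_contra hk1
      have hk2 : 2 ≤ Nat.find hex := by omega
      set P : geomPoints W := 2 ^ (Nat.find hex - 2) • (m : geomPoints W) with hP
      have hPfix : σ • P = P := by rw [hP, hact', hfixm]
      have hPP : P + P = U := by
        rw [hU, hP, ← two_pow_succ_nsmul, show Nat.find hex - 2 + 1 = Nat.find hex - 1 by omega]
      have hP0 : P ≠ 0 := by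
        intro h0
        rw [h0, add_zero] at hPP
        exact hU0 hPP.symm
      obtain ⟨xP, yP, hPns, hPeq⟩ := exists_eq_some_of_ne_zero W (K := Kb) hP0
      rw [hPeq, hact] at hPfix
      rw [hPeq, hUeq] at hPP
      exact step_ii hPfix hyU hPP
    -- so `m = U`
    have hmU : (m : geomPoints W) = U := by
      rw [hU, hk1]
      simp
    exact ⟨yU, hUns, hyU, hmU.trans hUeq⟩
  -- conclusion: two nonzero fixed points coincide (same `x = e₁`, and `y` is forced by `2y = −a₁e₁ − a₃`)
  obtain ⟨y, h, hy, hmeq⟩ := step_iii hm hm0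
  obtain ⟨y', h', hy', hmeq'⟩ := step_iii hm' hm0'
  have hyy : y = y' := by
    change y = -y - V.a₁ * E₁ - V.a₃ at hy
    change y' = -y' - V.a₁ * E₁ - V.a₃ at hy'
    have h2 : (2 : Kb) * (y - y') = 0 := by linear_combination hy - hy'
    exact sub_eq_zero.mp ((mul_eq_zero.mp h2).resolve_left hV2)
  subst hyy
  apply Subtype.ext
  rw [hmeq, hmeq']

/-- **The torsion count from one Galois element**: under the hypotheses of `eq_of_smul_eq_of_smul_eq`,
`#{m ∈ E(ℚ̄)[2^∞] : σ • m = m} ≤ 2`. [cite: SilvermanAEC2009, III.2.3 (d), VIII.§1] -/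
theorem natCard_fixedBy_le_two (σ : Field.absoluteGaloisGroup ℚ) (e₁ r s : ℚ)
    (he₁ : 4 * e₁ ^ 3 + W.b₂ * e₁ ^ 2 + 2 * W.b₄ * e₁ + W.b₆ = 0)
    (hr : 2 * r = W.a₁ ^ 2 * e₁ + W.a₁ * W.a₃ + 4 * W.a₂ * e₁ + 2 * W.a₄ + 6 * e₁ ^ 2)
    (hs : s = (W.b₂ + 4 * e₁) ^ 2 - 16 * (2 * W.b₄ + W.b₂ * e₁ + 4 * e₁ ^ 2))
    (hσr : ∀ α : AlgebraicClosure ℚ, α ^ 2 = algebraMap ℚ (AlgebraicClosure ℚ) r →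
      (show AlgebraicClosure ℚ ≃ₐ[ℚ] AlgebraicClosure ℚ from σ) α ≠ α)
    (hσs : ∀ β : AlgebraicClosure ℚ, β ^ 2 = algebraMap ℚ (AlgebraicClosure ℚ) s →
      (show AlgebraicClosure ℚ ≃ₐ[ℚ] AlgebraicClosure ℚ from σ) β ≠ β) :
    Nat.card {m : geomPrimaryTorsion W 2 // σ • m = m} ≤ 2 := by
  -- `m ↦ [m = 0]` is injective on the fixed points
  let f : {m : geomPrimaryTorsion W 2 // σ • m = m} → Bool := fun m ↦ decide (m.1 = 0)
  have hf : Function.Injective f := by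
    intro a b hab
    have hab' : (a.1 = 0 ↔ b.1 = 0) := by simpa [f] using hab
    by_cases ha : a.1 = 0
    · exact Subtype.ext (ha.trans (hab'.mp ha).symm)
    · have hb : b.1 ≠ 0 := fun hb ↦ ha (hab'.mpr hb)
      exact Subtype.ext (eq_of_smul_eq_of_smul_eq W σ e₁ r s he₁ hr hs hσr hσs a.2 ha b.2 hb)
  simpa using Nat.card_le_card_of_injective f hf

/-- **The layer-`j` torsion certificate `t = 1` from one Galois element of `Gal(ℚ̄/ℚ_j)`**: if some
`σ ∈ κ.layerSubgroup j` fixes no square root of `r` and none of `s` (data as above), then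
`#{m ∈ E[2^∞] : Gal(ℚ̄/ℚ_j) · m = m} ≤ 2^1` — the `htor` input of `towerRank_of_layerClasses_of_torsion` /
`towerRank_of_layerSelmer_of_torsion` and of the torsion-tolerant gap doors at ANY lower layer `j`.
[cite: SilvermanAEC2009, III.2.3 (d), VIII.§1] [cite: GreenbergLNM1716, §4 Lemma 4.3] -/
theorem natCard_fixedBy_layerSubgroup_le_two {κ : ZpExtension ℚ 2} {j : ℕ} (σ : Field.absoluteGaloisGroup ℚ)
    (hσ : σ ∈ κ.layerSubgroup j) (e₁ r s : ℚ)
    (he₁ : 4 * e₁ ^ 3 + W.b₂ * e₁ ^ 2 + 2 * W.b₄ * e₁ + W.b₆ = 0)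
    (hr : 2 * r = W.a₁ ^ 2 * e₁ + W.a₁ * W.a₃ + 4 * W.a₂ * e₁ + 2 * W.a₄ + 6 * e₁ ^ 2)
    (hs : s = (W.b₂ + 4 * e₁) ^ 2 - 16 * (2 * W.b₄ + W.b₂ * e₁ + 4 * e₁ ^ 2))
    (hσr : ∀ α : AlgebraicClosure ℚ, α ^ 2 = algebraMap ℚ (AlgebraicClosure ℚ) r →
      (show AlgebraicClosure ℚ ≃ₐ[ℚ] AlgebraicClosure ℚ from σ) α ≠ α)
    (hσs : ∀ β : AlgebraicClosure ℚ, β ^ 2 = algebraMap ℚ (AlgebraicClosure ℚ) s →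
      (show AlgebraicClosure ℚ ≃ₐ[ℚ] AlgebraicClosure ℚ from σ) β ≠ β) :
    Nat.card {m : geomPrimaryTorsion W 2 | ∀ τ ∈ κ.layerSubgroup j, τ • m = m} ≤ 2 ^ 1 := by
  rw [pow_one]
  -- `m ↦ [m = 0]` is injective on the layer-fixed points as well
  let f : {m : geomPrimaryTorsion W 2 | ∀ τ ∈ κ.layerSubgroup j, τ • m = m} → Bool :=
    fun m ↦ decide (m.1 = 0)
  have hf : Function.Injective f := by
    intro a b hab
    have hab' : (a.1 = 0 ↔ b.1 = 0) := by simpa [f] using hab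
    by_cases ha : a.1 = 0
    · exact Subtype.ext (ha.trans (hab'.mp ha).symm)
    · have hb : b.1 ≠ 0 := fun hb ↦ ha (hab'.mpr hb)
      exact Subtype.ext
        (eq_of_smul_eq_of_smul_eq W σ e₁ r s he₁ hr hs hσr hσs (a.2 σ hσ) ha (b.2 σ hσ) hb)
  simpa using Nat.card_le_card_of_injective f hf

end Galois

end Summit.BirchSwinnertonDyer.BirchSwinnertonDyer.Theorems.TowerLambdaTorsion

end
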